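import Summits.BirchSwinnertonDyer.Rank1Residual.X11b.AnticyclotomicControlCokernel
import Mathlib.NumberTheory.NumberField.Completion.InfinitePlace
import Mathlib.FieldTheory.IsAlgClosed.Basic
import HarnessLib

/-!
# X11b, route R1 — the INFINITE local conditions of Castella's Selmer group are vacuous over an
# imaginary quadratic field (`K_w = ℂ`): the control map's cokernel reduces to the places `v ∤ p`

HONEST FRAMING (cell `b2b-bsdres`, run/shared/lean/b2b/bsd-rank1-residual/, verbatim in every
file): the goal of the cell is to DELETE the COMBINATION-SHAPED residual classes of the
Birch–Swinnerton-Dyer formula for ALL analytic-rank `≤ 1` elliptic curves over `ℚ` — "full BSD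
formula for every rank `≤ 1` curve in class `C`" assembled STRICTLY from published theorems — so
that the rank-`≤ 1` remainder becomes exactly the CONSTRUCTION-SHAPED classes, which are TYPED
(missing-input `Prop`s), NOT attempted. This is not "finishing BSD". Sub-cell
`b2b-bsdres-multr1-p1` (X11b, route R1 = Castella 2018 Thm. A re-proved along the author's
erratum); a RESEARCH ROUTE; no claim beyond the stated class; X11b stays CONSTRUCTION-SHAPED;
nothing here changes a label; no named fact is minted (proved theorems only; no `sorry`).

## Why this file

`AnticyclotomicControlCokernel` (this gen) reduced the bijectivity of the control map
`s : Sel_𝔭^Σ(K, E[p^∞]) → Sel_𝔭^Σ(K_∞, E[p^∞])^Γ` on route R1 to two DESCENT hypotheses: the away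
conditions at the finite `v ∉ Σ`, `v ∤ p` (`hS`) and the conditions at the infinite places (`hinf`).
Castella's `K` is imaginary quadratic ("Let `K` be an imaginary quadratic field", Cas18 §2.1), so
every infinite place `w` of `K` is complex, `K_w ≅ ℂ` is algebraically closed, `Γ_{K_w}` is trivial
and the decomposition group `D_w ≤ Γ_K` is trivial: the local condition at `w` is VACUOUS over `K`
and over `K_∞` alike ("the archimedean primes split completely", Greenberg LNM 1716 §3 p. 87). This
file proves that on the tree's objects and discharges `hinf`, leaving `hS` — Greenberg's local
kernels at `v ∤ p` (Lemma 3.3; Castella's `Σ ⊇ {w ∣ N⁺}` and (5.2)) — as the ONLY undischarged input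
of the control isomorphism on tree objects.

## What is proved

* `subsingleton_absoluteGaloisGroup_of_isAlgClosed` — `Γ_F` is trivial for `F` algebraically closed
  (`F̄ = F`: Mathlib `IsAlgClosed.algebraMap_bijective_of_isIntegral`);
* `decompInf_eq_bot_of_isComplex` — at a complex place `w` (`K_w ≃ ℂ`, Mathlib
  `Completion.ringEquivComplexOfIsComplex`) the decomposition group `decompInf w` is trivial;
* `infConditions_descend_of_isTotallyComplex` — for totally complex `K`, ANY `ℤ_p`-extension, any
  `𝔭`, `Σ`: the hypothesis `hinf` of `controlMap_surjective_of_local_descent` HOLDS;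
* **`controlMap_bijective_of_away_descent`** (curve level) and
  **`ChainLocus.controlMap_bijective_of_away_descent`** (route R1, `K` imaginary quadratic — in
  particular every erratum field): `s` is BIJECTIVE as soon as the away conditions at the finite
  `v ∉ Σ`, `v ∤ p` descend from `K_∞` to `K`.

References: [GreenbergLNM1716] §3 p. 87 ("archimedean primes of `F` split completely in `F_∞/F`");
[Castella2018] §2.1, Def. 2.2 (arXiv:1704.06608 p. 5); [JetchevSkinnerWan2017] §3.3 (shape only).
-/

noncomputable section

open scoped Classical

open NumberField IsDedekindDomain Field
open Literature.NumberTheory.EllipticCurves Literature.NumberTheory.EllipticCurves.GreenbergSelmer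
open Literature.NumberTheory.GaloisRepresentations

universe u

namespace Summit.BirchSwinnertonDyer.Rank1Residual.X11b.AcSelmer

/-! ## Complex places have trivial decomposition groups -/

section Complex

/-- **`Γ_F` is trivial for `F` algebraically closed**: `F̄` is an algebraic extension of `F`, so
`F → F̄` is onto (Mathlib `IsAlgClosed.algebraMap_bijective_of_isIntegral`) and every
`F`-automorphism of `F̄` is the identity. [folklore] -/
theorem subsingleton_absoluteGaloisGroup_of_isAlgClosed (F : Type u) [Field F] [IsAlgClosed F] :
    Subsingleton (absoluteGaloisGroup F) := by
  refine ⟨fun σ τ ↦ AlgEquiv.ext fun x ↦ ?_⟩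
  obtain ⟨y, rfl⟩ :=
    (IsAlgClosed.algebraMap_bijective_of_isIntegral (k := F) (K := AlgebraicClosure F)).2 x
  rw [AlgEquiv.commutes, AlgEquiv.commutes]

/-- **At a complex place the decomposition group is trivial**: `K_w ≃ ℂ`
(`Completion.ringEquivComplexOfIsComplex`) is algebraically closed, so `Γ_{K_w}` is trivial and its
image `decompInf w ≤ Γ_K` is `⊥`. [cite: GreenbergLNM1716, §3 p. 87 (archimedean primes split completely)] -/
theorem decompInf_eq_bot_of_isComplex {K : Type} [Field K] [NumberField K] {w : InfinitePlace K}
    (hw : w.IsComplex) : decompInf w = ⊥ := by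
  haveI : IsAlgClosed w.Completion :=
    IsAlgClosed.of_ringEquiv ℂ w.Completion
      (InfinitePlace.Completion.ringEquivComplexOfIsComplex hw).symm
  haveI := subsingleton_absoluteGaloisGroup_of_isAlgClosed w.Completion
  rw [eq_bot_iff]
  rintro g ⟨σ, rfl⟩
  rw [Subsingleton.elim σ 1, map_one]
  exact (⊥ : Subgroup (absoluteGaloisGroup K)).one_mem

end Complex

/-! ## The infinite conditions descend (indeed are vacuous) for totally complex `K` -/

section Descent

variable {K : Type} [Field K] [NumberField K] (W : WeierstrassCurve K) (p : ℕ) [Fact p.Prime]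
  (κ : ZpExtension K p) (𝔭 : HeightOneSpectrum (𝓞 K)) (S : Set (HeightOneSpectrum (𝓞 K)))

/-- **The hypothesis `hinf` of `controlMap_surjective_of_local_descent` holds for totally complex
`K`** (every infinite place complex, e.g. `K` imaginary quadratic): if `res_{K→K_∞} c` lies in
`Sel_𝔭^Σ(K_∞, E[p^∞])` then `c` satisfies the infinite conditions over `K` — `decompInf w = ⊥ ≤ ker κ`
and `resOfLe_mem_infKer_iff_of_decompInf_le`. [cite: GreenbergLNM1716, §3 p. 87 (archimedean primes split completely)] -/
theorem infConditions_descend_of_isTotallyComplex [IsTotallyComplex K]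
    (c : W.subgroupH1 p (⊤ : Subgroup (absoluteGaloisGroup K)))
    (hc : W.resOfLe p (le_top : κ.kerSubgroup ≤ ⊤) c ∈ selmerAc W p κ 𝔭 S) (w : InfinitePlace K) :
    c ∈ infKer ⊤ (W.geomPrimaryTorsion p) w := by
  have hD : decompInf w ≤ κ.kerSubgroup := by
    rw [decompInf_eq_bot_of_isComplex (IsTotallyComplex.isComplex w)]
    exact bot_le
  have h1 := ((mem_selmerOver_iff _).mp hc).2.1 w 1
  rw [conjH1_one_holds, AddMonoidHom.id_apply] at h1
  exact (resOfLe_mem_infKer_iff_of_decompInf_le w hD c).mp h1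

/-- **`s` is BIJECTIVE modulo AWAY descent, for totally complex `K`**: `Sel_𝔭^Σ(K, E[p^∞]) ≅
Sel_𝔭^Σ(K_∞, E[p^∞])^γ` as soon as `H¹(K, E[p^∞]) ↪ H¹(K_∞, E[p^∞])`, `E(K̄)[p^∞]^{D_𝔭 ⊓ ker κ} = 0`,
and the away conditions at the finite `v ∉ Σ`, `v ∤ p` descend (`controlMap_bijective_of_local_descent`
with `hinf` discharged). [cite: GreenbergLNM1716, §3 p. 90 (Thm. 1.2 from Lemmas 3.1, 3.2, 3.5)] [cite: JetchevSkinnerWan2017, §3.3 (control; shape only)] -/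
theorem controlMap_bijective_of_away_descent [IsTotallyComplex K] {γ : absoluteGaloisGroup K}
    (hγ : κ.IsTopGenerator γ)
    (hinj : Function.Injective (ResKernel.resSubgroup κ.kerSubgroup (W.geomPrimaryTorsion p)))
    (h0 : FixedPoints.addSubgroup ↥(decomp 𝔭 ⊓ κ.kerSubgroup) (W.geomPrimaryTorsion p) = ⊥)
    (hS : ∀ c : W.subgroupH1 p (⊤ : Subgroup (absoluteGaloisGroup K)),
      W.resOfLe p (le_top : κ.kerSubgroup ≤ ⊤) c ∈ selmerAc W p κ 𝔭 S →
        ∀ v : HeightOneSpectrum (𝓞 K), ((p : ℕ) : 𝓞 K) ∉ v.asIdeal → v ∉ S →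
          c ∈ awayKer ⊤ (W.geomPrimaryTorsion p) v) :
    Function.Bijective (controlMap W p κ 𝔭 S γ) :=
  controlMap_bijective_of_local_descent p κ W 𝔭 S hγ hinj h0 hS
    (fun c hc w ↦ infConditions_descend_of_isTotallyComplex W p κ 𝔭 S c hc w)

end Descent

end Summit.BirchSwinnertonDyer.Rank1Residual.X11b.AcSelmer

/-! ## Route R1: imaginary quadratic `K` -/

namespace Summit.BirchSwinnertonDyer.Rank1Residual.X11b

section RouteR1

open AcSelmer Literature.NumberTheory.EllipticCurves.Rank1Residual

variable {W : WeierstrassCurve ℚ} [W.IsElliptic] [W.IsGloballyMinimal] {p : ℕ} [Fact p.Prime]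

/-- **Control for route R1 modulo the local kernels at `v ∤ p`.** On route R1's population
(`ChainLocus`), for EVERY imaginary quadratic `K` (`IsImaginaryQuadratic`, e.g. every erratum
field), EVERY degree-one `𝔭 ∣ p`, EVERY `ℤ_p`-extension `κ` with topological generator `γ`, every
`Σ`: `s : Sel_𝔭^Σ(K, E[p^∞]) → Sel_𝔭^Σ(K_∞, E[p^∞])^γ` is BIJECTIVE as soon as the away conditions at
the finite `v ∉ Σ`, `v ∤ p` descend from `K_∞` to `K` — injectivity from `Irr ∧ Ram`, the strict place
from (iv), the lift from Lemma 3.2, the infinite places from `K_w = ℂ`. The one undischarged input is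
Greenberg's `ker r_v` at `v ∤ p` (trivial where `v` splits completely in `K_∞`,
`resOfLe_mem_awayKer_iff_of_decomp_le`; Lemma 3.3 / Castella's (5.2) elsewhere).
[cite: JetchevSkinnerWan2017, §3.3 and Thm. 3.3.1 (shape only)] [cite: Castella2018, §2.1 and Thm. 2.3 (arXiv:1704.06608 p. 5)] [cite: GreenbergLNM1716, §3 pp. 85–90] -/
theorem ChainLocus.controlMap_bijective_of_away_descent (h : ChainLocus W p)
    (K : Type) [Field K] [NumberField K] (hK : IsImaginaryQuadratic K) (κ : ZpExtension K p)
    {γ : absoluteGaloisGroup K} (hγ : κ.IsTopGenerator γ) (𝔭 : HeightOneSpectrum (𝓞 K))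
    (h𝔭 : ((p : ℕ) : 𝓞 K) ∈ 𝔭.asIdeal) (he : 𝔭.asIdeal.ramificationIdx (𝓞 ℚ) = 1)
    (hf : 𝔭.asIdeal.inertiaDeg (𝓞 ℚ) = 1) (S : Set (HeightOneSpectrum (𝓞 K)))
    (hS : ∀ c : (W.baseChange K).subgroupH1 p (⊤ : Subgroup (absoluteGaloisGroup K)),
      (W.baseChange K).resOfLe p (le_top : κ.kerSubgroup ≤ ⊤) c ∈ selmerAc (W.baseChange K) p κ 𝔭 S →
        ∀ v : HeightOneSpectrum (𝓞 K), ((p : ℕ) : 𝓞 K) ∉ v.asIdeal → v ∉ S →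
          c ∈ awayKer ⊤ ((W.baseChange K).geomPrimaryTorsion p) v) :
    Function.Bijective (controlMap (W.baseChange K) p κ 𝔭 S γ) := by
  haveI : IsTotallyComplex K := hK.2
  exact AcSelmer.controlMap_bijective_of_away_descent (W.baseChange K) p κ 𝔭 S hγ
    (h.resSubgroup_kerSubgroup_injective K hK.1 κ)
    (h.fixedPoints_decomp_inf_kerSubgroup_eq_bot K κ 𝔭 h𝔭 he hf) hS

/-- **On an erratum field** (`IsErratumField`, imaginary quadratic with `p ∣ N_E` split): the same,
for every `𝔭 ∋ p` (degree one automatically, `degreeOne_of_splitsIn`), every `κ`, `γ`, `Σ`.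
[cite: Castella2018, §5 (arXiv:1704.06608 p. 12), choice of K] [cite: Castella2018, Thm. 2.3 (arXiv:1704.06608 p. 5)] -/
theorem ChainLocus.controlMap_bijective_of_away_descent_of_isErratumField (h : ChainLocus W p)
    {q : ℕ} (K : Type) [Field K] [NumberField K] (hKf : IsErratumField W K q) (hpq : p ≠ q)
    (hpN : p ∣ W.conductorNorm ℤ) (κ : ZpExtension K p)
    {γ : absoluteGaloisGroup K} (hγ : κ.IsTopGenerator γ) (𝔭 : HeightOneSpectrum (𝓞 K))
    (h𝔭 : ((p : ℕ) : 𝓞 K) ∈ 𝔭.asIdeal) (S : Set (HeightOneSpectrum (𝓞 K)))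
    (hS : ∀ c : (W.baseChange K).subgroupH1 p (⊤ : Subgroup (absoluteGaloisGroup K)),
      (W.baseChange K).resOfLe p (le_top : κ.kerSubgroup ≤ ⊤) c ∈ selmerAc (W.baseChange K) p κ 𝔭 S →
        ∀ v : HeightOneSpectrum (𝓞 K), ((p : ℕ) : 𝓞 K) ∉ v.asIdeal → v ∉ S →
          c ∈ awayKer ⊤ ((W.baseChange K).geomPrimaryTorsion p) v) :
    Function.Bijective (controlMap (W.baseChange K) p κ 𝔭 S γ) :=
  have hsplit : SplitsIn K p := hKf.2.2.1 p (Fact.out : p.Prime) hpN hpq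
  h.controlMap_bijective_of_away_descent K hKf.1 κ hγ 𝔭 h𝔭
    (degreeOne_of_splitsIn hKf.1.1 hsplit h𝔭).1 (degreeOne_of_splitsIn hKf.1.1 hsplit h𝔭).2 S hS

end RouteR1

end Summit.BirchSwinnertonDyer.Rank1Residual.X11b

end
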